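import Literature.MathematicalPhysics.QuantumFieldTheory.Balaban1983to89.B9Eq370Expansion
import Literature.MathematicalPhysics.QuantumFieldTheory.Balaban1983to89.B7Eq84Concrete

/-!
# `Balaban1983to89.B9AppChiral` — B9, Appendix pp. 432–433, (3.188)–(3.193): PROPAGATORS FOR NON-LINEAR CHIRAL MODELS — the
# action `A^η(U) = Σ_b η^{d−2}[1 − Re tr U(∂b)]`, `U(∂b) = U(b₋)U⁻¹(b₊)` (3.188), its expansion around a background
# `A^η(U′U) = A^η(U) + ⟨∂A, J⟩ + ½⟨A, Δ^η(U)A⟩ + ⋯` (3.189) with `J = −η⁻¹ Im U(∂b)` (3.190), `Δ^η(U) = ∂*∂ + Δ′^η(U)` (3.191) and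
# `⟨A, Δ′^η(U)A⟩` (3.192) — PROVED as an exact identity with third-order remainder; the non-linear average `Q_j(U, A)` (3.193) typed;
# kernel-checked; v1

statement-level skeleton of published theorems with citation tags; proofs where landed; nothing here is a claim about the Yang–Mills mass gap

CITATION HEADER (lean-in-tree rule).  Cell `lit-balaban` (mega-formalization of Bałaban CMP 1983–89), reader/typer seat
`lit-balaban-r06` (row `B9.App` of `run/shared/lean/pub/lit-balaban/lit-balaban-r06/ROWS-B9.md`).  Source: T. Bałaban,
*Propagators for lattice gauge theories in a background field*, Commun. Math. Phys. **99** (1985) 389–434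
[Balaban1985BackgroundPropagators] (cell paper B9; journal page = PDF page + 388), Appendix pp. 432–433 [PDF 44–45], quoted from
the page renders `b2b-balaban-ref1/pages/1985-cmp99-background-propagators/…-p044-x4.png`, `…-p045-x4.png` READ AS IMAGES by this
seat (2026-08-20); the averaging operations of (3.193) are those of [5] = T. Bałaban, *Averaging operations for lattice gauge
theories*, Commun. Math. Phys. **98** (1985) 17–51 [Balaban1985Averaging], (78)–(80) p. 30, in the tree as `B7Eq99Concrete.savg`,
`B7Eq84Concrete.uavg`.

HONEST FRAMING (cell charter).  The appendix is two «remarks» reducing chiral models to the scalar-field machinery of [2, 4]; no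
theorem is stated there.  THIS FILE types its displayed objects and PROVES the one display that is an identity, (3.189)–(3.192), as
an exact second-order expansion with a third-order remainder (the bond analogue of `B9Eq39Adjoint.eq312`); it proves nothing about
propagators.  NOT summit progress.

ABSOLUTE RULE.  No internally-minted statement enters as a cited fact: every `theorem` below is PROVED; the `[cite: …]` tags say
which printed display a definition or a proved statement transcribes.  No `def … : Prop`.

WHAT IS IN PRINT («…» verbatim up to notation, pp. 432–433).
«Field configurations in these models are the same as configurations defining gauge transformations for gauge field theories,
i.e. they are functions U : T_η → G. An action for a model determined by a Lie group G is given by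
A^η(U) = Σ_{b⊂T_η} η^{d−2}[1 − Re tr U(∂b)],  U(∂b) = (∂U)(b) = U(b₋)U⁻¹(b₊). (3.188)  Let us notice that Re tr U(∂b) = Re tr U⁻¹(b₋)U(b₊).
As for gauge field theories we have to expand the action around a background configuration, thus we take U′U instead of U, with
U′ = e^{iA}, A ∈ 𝔤. Expanding A^η(U′U) up to second order in A we get
A^η(U′U) = Σ_{b⊂T_η} η^{d−2}[1 − Re tr exp iη(−(∂A)(b) + ½i[A(b₋), (∂A)(b)] + ⋯)·U(∂b)] = A^η(U) + ⟨A, J⟩ + ½⟨A, Δ^η(U)A⟩ + ⋯, (3.189)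
where J = −η⁻¹ Im U(∂b), (3.190)  Δ^η(U) = ∂*∂ + Δ′^η(U) = Δ + Δ′^η(U), (3.191) and
⟨A, Δ′^η(U)A⟩ = Σ_{b⊂T_η} η^d[tr((∂¹A)(b))²η⁻²[Re U(∂b) − 1] + i[A(b₋), (∂A)(b)]η⁻¹ Im U(∂b)]. (3.192)
We consider only regular background fields U, for which the operator Δ′^η(U) is a first order differential operator with sufficiently
small coefficients. … A similar situation holds for averaging operations. They are given by the formulas (61), (78)–(80) in [5], with
the external gauge field U₀ = 1. Taking Q_j(U, A) = (1/i) log Ū′^j = (1/i) log (U′U)‾^j (Ū^j)⁻¹ (3.193) and expanding in A, we can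
easily see that for the linear term we have Q_j(U)A = Q′_jA + F_{2,j}(U)A, (3.194) where the operator F_{2,j}(U) is small.»
READING NOTES. (i) In (3.189) `∂ = ∂^η` (`(∂A)(b) = η⁻¹(A(b₊) − A(b₋))`) and `U′ = e^{iA}` carries no `η`; the `⟨A, J⟩` of (3.189) pairs
the BOND function `J` of (3.190) with `∂A`: `⟨∂A, J⟩ = Σ_b η^d tr (∂A)(b)J(b)` (equivalently `⟨A, ∂*J⟩`) — this is what the expansion
gives and what is proved below. (ii) In (3.192) the scan shows `η²`; the dimensionally consistent reading, parallel to (3.10), is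
`tr((∂¹A)(b))²η⁻²` = `tr((∂^ηA)(b))²`, which is what the expansion gives.

WHAT THIS FILE PROVES / TYPES.  MODEL = that of `B9Eq39Adjoint` (finite site set `S`, directions `ι`, shifts `T μ : S ≃ S`, a
complete normed ℂ-algebra `𝔸` with units for «G», tracial `τ` for «tr», complexified `Re`/`Im` of p. 391); the chiral field is
`V : S → 𝔸ˣ`; `∂¹ = covD T 1` (the covariant derivative of `B9Eq39Adjoint` at the trivial background).
* §1 (3.188): `bondU V μ x = V(x)V(x+e_μ)⁻¹` («U(∂b) = U(b₋)U⁻¹(b₊)»), `chiralAction` («A^η(U)», complexified as `B9Eq39Adjoint.action`),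
  `wil_bondU_rev` («Re tr U(∂b) = Re tr U⁻¹(b₋)U(b₊)»).
* §2 (3.189)–(3.192): `pdη` (`∂^η`), `Jb` («J = −η⁻¹ Im U(∂b)» (3.190)), `deltaPrimeCh` ((3.192) letter for letter), `hessCh`
  («⟨A,Δ^η(U)A⟩ = ⟨∂A,∂A⟩ + ⟨A,Δ′A⟩» (3.191)), `remCh` (third-order remainder per bond); `wil_bondU_fluct` (the bond variable of `U′U`
  under `τ`: `e^{−iA(b₊)}e^{iA(b₋)}U(∂b)`, the print's `exp iη(−(∂A)(b) + ½i[A(b₋),(∂A)(b)] + ⋯)·U(∂b)` — `sum_letters2`,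
  `commSum_letters2` are its first- and second-order data), **`eq3189`**: `A^η(U′U) = A^η(U) + ⟨∂A, J⟩ + ½⟨A, Δ^η(U)A⟩ + η^{d−2}Σ_b ρ_b`
  EXACTLY for an arbitrary background of units, `η ≠ 0`, `d ≥ 2`, and `norm_remCh_le` (ρ_b third order, `B9Eq37Insertion.norm_rem_le`
  BY NAME); `bondPair_pdη_pdη` (`⟨∂A, ∂A⟩ = ⟨A, ∂*∂A⟩`, adjointness (3.8) at `U ≡ 1`, `B9Eq39Adjoint.sum_sum_covD_mul` BY NAME).
* §3 (3.193): `Qj` — «Q_j(U, A) = (1/i) log (U′U)‾^j (Ū^j)⁻¹» with the `j`-fold site average of [5] (78)–(80) at `U₀ = 1`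
  (`B7Eq84Concrete.uavg L 1`, on the `ℤ^d` sites of the tree's formalization of [5]) and the logarithm series `MatrixLog.mlog`; typed
  as a definition with a body, `Qj_zero` (at `A = 0` it vanishes).  (3.194) is a smallness remark without a printed constant: NOT typed.
* §4 sanity examples.

RELATED IN THE TREE, NOT DUPLICATED (searched 2026-08-20: `lean search chiral|bondU|"(3.188)"|"(3.19[0-4])"`, grep over
`Balaban1983to89/`): nothing on the appendix; `B9Eq39Adjoint.eq312` is the PLAQUETTE expansion (3.12) whose bond analogue is `eq3189`;
`B7Eq99Concrete`/`B7Eq84Concrete` supply the averages used BY NAME in §3.  NOT summit progress.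
-/

noncomputable section

namespace Literature.MathematicalPhysics.QuantumFieldTheory.Balaban1983to89.B9AppChiral

open NormedSpace Complex
open Literature.MathematicalPhysics.QuantumFieldTheory.Balaban1983to89
open Literature.MathematicalPhysics.QuantumFieldTheory.Balaban1983to89.Beta.TransportVertices
open Literature.MathematicalPhysics.QuantumFieldTheory.Balaban1983to89.Beta.AdjointTransportJets (invPath invPath_cons invPath_nil)
open Literature.MathematicalPhysics.QuantumFieldTheory.Balaban1983to89.Beta.BackgroundVertices (ad ad_apply ad_smul_left
  ad_smul_right ad_sub_left ad_sub_right)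
open Literature.MathematicalPhysics.QuantumFieldTheory.Balaban1983to89.B9Eq37Insertion
open Literature.MathematicalPhysics.QuantumFieldTheory.Balaban1983to89.B9Eq39Adjoint

/-! ## §1  (3.188): the chiral field, its bond variable and the action -/

section Action

variable {𝔸 : Type*} [NormedRing 𝔸] [NormedAlgebra ℂ 𝔸] [CompleteSpace 𝔸] {S : Type*} {ι : Type*}
variable (T : ι → Equiv.Perm S)

omit [NormedAlgebra ℂ 𝔸] [CompleteSpace 𝔸] in
/-- (3.188): the bond variable of a chiral field `U : T_η → G`, «U(∂b) = (∂U)(b) = U(b₋)U⁻¹(b₊)», on the positive bond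
`b = ⟨x, x + e_μ⟩`. [folklore] [cite: Balaban1985BackgroundPropagators, (3.188) p.432] -/
def bondU (V : S → 𝔸ˣ) (μ : ι) (x : S) : 𝔸ˣ := V x * (V (T μ x))⁻¹

omit [NormedAlgebra ℂ 𝔸] [CompleteSpace 𝔸] in
/-- Unfolding `bondU`. [folklore] [cite: Balaban1985BackgroundPropagators, (3.188) p.432] -/
theorem bondU_apply (V : S → 𝔸ˣ) (μ : ι) (x : S) : bondU T V μ x = V x * (V (T μ x))⁻¹ := rfl

omit [CompleteSpace 𝔸] in
/-- «Let us notice that Re tr U(∂b) = Re tr U⁻¹(b₋)U(b₊)» (p. 432): under a tracial `τ` the bond variable may be read in either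
grouping. [folklore] [cite: Balaban1985BackgroundPropagators, p.432] -/
theorem wil_bondU_rev (τ : 𝔸 →ₗ[ℂ] ℂ) (hτ : ∀ a b : 𝔸, τ (a * b) = τ (b * a)) (V : S → 𝔸ˣ) (μ : ι) (x : S) :
    wil τ (bondU T V μ x) = wil τ ((V x)⁻¹ * V (T μ x)) := by
  rw [bondU, wil_mul_comm τ hτ, ← wil_inv, mul_inv_rev, inv_inv]

variable [Fintype S] [Fintype ι]

omit [CompleteSpace 𝔸] in
/-- (3.188): the action of the chiral model, «A^η(U) = Σ_{b⊂T_η} η^{d−2}[1 − Re tr U(∂b)]», in the complexified reading of p. 391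
(`B9Eq37Insertion.wil τ W = τ1 − τ Re W`). [folklore] [cite: Balaban1985BackgroundPropagators, (3.188) p.432] -/
def chiralAction (η : ℝ) (d : ℕ) (τ : 𝔸 →ₗ[ℂ] ℂ) (V : S → 𝔸ˣ) : ℂ :=
  ∑ x, ∑ μ, (η : ℂ) ^ (d - 2) * wil τ (bondU T V μ x)

end Action

/-! ## §2  (3.189)–(3.192): the expansion around a background, exactly -/

section Expansion

variable {𝔸 : Type*} [NormedRing 𝔸] [NormedAlgebra ℂ 𝔸] [CompleteSpace 𝔸] {S : Type*} {ι : Type*}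
variable (T : ι → Equiv.Perm S)

omit [CompleteSpace 𝔸] in
/-- `∂^η` on site functions, as a bond function: `(∂^ηA)(b) = η⁻¹(A(b₊) − A(b₋))` — the covariant derivative (3.3) at the trivial
background («∂*∂ = Δ», (3.191)). [folklore] [cite: Balaban1985BackgroundPropagators, (3.191) p.433, (3.3) p.390] -/
def pdη (η : ℝ) (A : S → 𝔸) : ι → S → 𝔸 := fun μ x => ((η : ℂ)⁻¹) • covD T 1 μ A x

omit [CompleteSpace 𝔸] in
/-- `(∂^ηA)_μ(x) = η⁻¹(A(x+e_μ) − A(x))`. [folklore] [cite: Balaban1985BackgroundPropagators, (3.191) p.433] -/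
theorem pdη_apply (η : ℝ) (A : S → 𝔸) (μ : ι) (x : S) : pdη T η A μ x = ((η : ℂ)⁻¹) • (A (T μ x) - A x) := by
  simp [pdη, covD]

omit [CompleteSpace 𝔸] in
/-- (3.190): «J = −η⁻¹ Im U(∂b)», a bond function (complexified `Im`). [folklore] [cite: Balaban1985BackgroundPropagators, (3.190) p.433] -/
def Jb (η : ℝ) (V : S → 𝔸ˣ) : ι → S → 𝔸 := fun μ x => -(((η : ℂ)⁻¹) • imC (bondU T V μ x))

omit [CompleteSpace 𝔸] in
/-- The two fluctuation letters of the bond `b = ⟨x, x+e_μ⟩` read at `b₋`: `−iA(b₊)`, `iA(b₋)` (`U′ = e^{iA}`, p. 433). [folklore]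
[cite: Balaban1985BackgroundPropagators, (3.189) p.433] -/
def letters2 (A : S → 𝔸) (μ : ι) (x : S) : List 𝔸 := [-(I • A (T μ x)), I • A x]

/-- The third-order remainder of one bond (`B9Eq37Insertion.rem` along the two letters and along the inverse path), WITHOUT the
`η^{d−2}` of (3.188). [folklore] [cite: Balaban1985BackgroundPropagators, (3.189) p.433] -/
def remCh (τ : 𝔸 →ₗ[ℂ] ℂ) (V : S → 𝔸ˣ) (A : S → 𝔸) (μ : ι) (x : S) : ℂ :=
  -(2 : ℂ)⁻¹ * (τ (rem (letters2 T A μ x) * (bondU T V μ x : 𝔸))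
    + τ ((((bondU T V μ x)⁻¹ : 𝔸ˣ) : 𝔸) * rem (invPath (letters2 T A μ x))))

omit [CompleteSpace 𝔸] in
/-- The size of the two letters: `‖iA(b₊)‖ + ‖iA(b₋)‖ = ‖A(b₊)‖ + ‖A(b₋)‖`. [folklore] [cite: Balaban1985BackgroundPropagators, (3.189) p.433] -/
theorem size_letters2 (A : S → 𝔸) (μ : ι) (x : S) : size (letters2 T A μ x) = ‖A (T μ x)‖ + ‖A x‖ := by
  simp [letters2, size, norm_smul]

/-- The remainder of one bond is THIRD ORDER: `‖ρ_b‖ ≤ ½‖τ‖(‖U(∂b)‖ + ‖U(∂b)⁻¹‖)·expTail 3 (‖A(b₊)‖ + ‖A(b₋)‖)`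
(`B9Eq37Insertion.norm_rem_le` BY NAME; «+ ⋯» of (3.189)). [folklore] [cite: Balaban1985BackgroundPropagators, (3.189) p.433] -/
theorem norm_remCh_le (τ : 𝔸 →L[ℂ] ℂ) (V : S → 𝔸ˣ) (A : S → 𝔸) (μ : ι) (x : S) :
    ‖remCh T (τ : 𝔸 →ₗ[ℂ] ℂ) V A μ x‖
      ≤ 2⁻¹ * ‖τ‖ * (‖(bondU T V μ x : 𝔸)‖ + ‖(((bondU T V μ x)⁻¹ : 𝔸ˣ) : 𝔸)‖) * expTail 3 (‖A (T μ x)‖ + ‖A x‖) := by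
  rw [remCh, neg_mul, norm_neg, ← size_letters2 T A μ x]
  exact norm_rem_le τ _ _

variable [Fintype S] [Fintype ι]

omit [CompleteSpace 𝔸] in
/-- (3.192): «⟨A, Δ′^η(U)A⟩ = Σ_{b⊂T_η} η^d[tr((∂¹A)(b))²η⁻²[Re U(∂b) − 1] + tr i[A(b₋), (∂A)(b)]η⁻¹ Im U(∂b)]», letter for letter
(`(∂¹A)²η⁻² = (∂^ηA)²`, complexified `Re`/`Im`). [folklore] [cite: Balaban1985BackgroundPropagators, (3.192) p.433] -/
def deltaPrimeCh (η : ℝ) (d : ℕ) (τ : 𝔸 →ₗ[ℂ] ℂ) (V : S → 𝔸ˣ) (A : S → 𝔸) : ℂ :=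
  (η : ℂ) ^ d * ∑ x, ∑ μ,
    (τ (pdη T η A μ x * pdη T η A μ x * (reC (bondU T V μ x) - 1))
      + τ ((I • ad (A x) (pdη T η A μ x)) * (((η : ℂ)⁻¹) • imC (bondU T V μ x))))

omit [CompleteSpace 𝔸] in
/-- (3.191): «Δ^η(U) = ∂*∂ + Δ′^η(U)» as the quadratic form `⟨A, Δ^η(U)A⟩ = ⟨∂^ηA, ∂^ηA⟩ + ⟨A, Δ′^η(U)A⟩` (bond pairing (3.11)
`B9Eq39Adjoint.bondPair`). [folklore] [cite: Balaban1985BackgroundPropagators, (3.191) p.433] -/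
def hessCh (η : ℝ) (d : ℕ) (τ : 𝔸 →ₗ[ℂ] ℂ) (V : S → 𝔸ˣ) (A : S → 𝔸) : ℂ :=
  bondPair η d τ (pdη T η A) (pdη T η A) + deltaPrimeCh T η d τ V A

omit [CompleteSpace 𝔸] in
/-- `⟨∂^ηA, ∂^ηA⟩ = ⟨A, ∂*∂^ηA⟩`: the `∂*∂` of (3.191) is the adjoint form ((3.8) at the trivial background,
`B9Eq39Adjoint.sum_sum_covD_mul` BY NAME; `∂* = D*` of (3.8) at `U ≡ 1` with its `η⁻¹`). [folklore]
[cite: Balaban1985BackgroundPropagators, (3.191) p.433, (3.8) p.392] -/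
theorem bondPair_pdη_pdη (τ : 𝔸 →ₗ[ℂ] ℂ) (hτ : ∀ a b : 𝔸, τ (a * b) = τ (b * a)) (η : ℝ) (d : ℕ) (A : S → 𝔸) :
    bondPair η d τ (pdη T η A) (pdη T η A)
      = (η : ℂ) ^ d * ∑ x, τ (A x * (((η : ℂ)⁻¹) • divB T 1 (pdη T η A) x)) := by
  have h : ∀ x μ, τ (pdη T η A μ x * pdη T η A μ x) = ((η : ℂ)⁻¹) * τ (covD T 1 μ A x * pdη T η A μ x) := by
    intro x μ
    rw [show pdη T η A μ x * pdη T η A μ x = ((η : ℂ)⁻¹) • (covD T 1 μ A x * pdη T η A μ x) by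
      rw [pdη, smul_mul_assoc], map_smul, smul_eq_mul]
  simp only [bondPair, h, ← Finset.mul_sum, mul_smul_comm, map_smul, smul_eq_mul]
  rw [sum_sum_covD_mul T 1 τ hτ A]

omit [Fintype S] [Fintype ι] in
/-- THE BOND VARIABLE OF `U′U` UNDER `τ`: with `U′ = e^{iA}` sitewise, `wil τ ((U′U)(∂b)) = wil τ (e^{−iA(b₊)}e^{iA(b₋)}·U(∂b))` —
the print's «Re tr exp iη(−(∂A)(b) + ½i[A(b₋),(∂A)(b)] + ⋯)·U(∂b)» before combining the exponentials. [folklore]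
[cite: Balaban1985BackgroundPropagators, (3.189) p.433] -/
theorem wil_bondU_fluct (τ : 𝔸 →ₗ[ℂ] ℂ) (hτ : ∀ a b : 𝔸, τ (a * b) = τ (b * a)) (V : S → 𝔸ˣ) (A : S → 𝔸) (μ : ι) (x : S) :
    wil τ (bondU T (fun y => holU [I • A y] * V y) μ x) = wil τ (holU (letters2 T A μ x) * bondU T V μ x) := by
  have h1 : bondU T (fun y => holU [I • A y] * V y) μ x = (holU [I • A x] * bondU T V μ x) * (holU [I • A (T μ x)])⁻¹ := by
    simp only [bondU, mul_inv_rev, mul_assoc]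
  have h2 : holU (letters2 T A μ x) * bondU T V μ x = (holU [I • A (T μ x)])⁻¹ * (holU [I • A x] * bondU T V μ x) := by
    ext
    simp only [letters2, Units.val_mul, val_holU, val_inv_holU, invPath_cons, invPath_nil, List.nil_append, holonomy_cons,
      holonomy_nil, mul_one, mul_assoc]
  rw [h1, h2, wil_mul_comm τ hτ]

omit [CompleteSpace 𝔸] [Fintype S] [Fintype ι] in
/-- FIRST ORDER: the letter sum is `−iη(∂^ηA)(b)` («exp iη(−(∂A)(b) + …)»). [folklore] [cite: Balaban1985BackgroundPropagators, (3.189) p.433] -/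
theorem sum_letters2 {η : ℝ} (hη : η ≠ 0) (A : S → 𝔸) (μ : ι) (x : S) :
    (letters2 T A μ x).sum = -(((I * η : ℂ)) • pdη T η A μ x) := by
  have hη' : (η : ℂ) ≠ 0 := Complex.ofReal_ne_zero.mpr hη
  simp only [letters2, List.sum_cons, List.sum_nil, add_zero, pdη_apply, smul_sub, smul_smul, mul_assoc,
    mul_inv_cancel₀ hη', mul_one]
  abel

omit [CompleteSpace 𝔸] [Fintype S] [Fintype ι] in
/-- SECOND ORDER: the ordered commutator of the two letters is `−η[A(b₋), (∂^ηA)(b)]`, so that `½·` it is the print's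
`iη·½i[A(b₋),(∂A)(b)]`. [folklore] [cite: Balaban1985BackgroundPropagators, (3.189) p.433] -/
theorem commSum_letters2 {η : ℝ} (hη : η ≠ 0) (A : S → 𝔸) (μ : ι) (x : S) :
    commSum (letters2 T A μ x) = -((η : ℂ) • ad (A x) (pdη T η A μ x)) := by
  have hη' : (η : ℂ) ≠ 0 := Complex.ofReal_ne_zero.mpr hη
  rw [pdη_apply, ad_smul_right, smul_smul, mul_inv_cancel₀ hη', one_smul]
  simp only [letters2, commSum_cons, commSum_nil, List.sum_cons, List.sum_nil, add_zero, zero_add, mul_zero, zero_mul,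
    smul_zero, ad_apply, mul_sub, sub_mul, smul_mul_assoc, mul_smul_comm, smul_smul, neg_mul, mul_neg, smul_neg, I_mul_I,
    neg_smul, one_smul, neg_neg]
  abel

omit [Fintype S] [Fintype ι] in
/-- THE (3.189) SUMMAND OF ONE BOND, REARRANGED INTO THE (3.190)–(3.192) TERMS: with `X = (∂^ηA)(b)`, `W = U(∂b)`,
`η^{d−2}(wil τ(P·W) − wil τ W) = η^d τ(X·J(b)) + ½[η^d τ(X²) + η^d(τ(X²(Re W − 1)) + τ(i[A(b₋),X]·η⁻¹Im W))] + η^{d−2}ρ_b`.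
[folklore] [cite: Balaban1985BackgroundPropagators, (3.189)–(3.192) p.433] -/
theorem summand_split (τ : 𝔸 →ₗ[ℂ] ℂ) (hτ : ∀ a b : 𝔸, τ (a * b) = τ (b * a)) {η : ℝ} (hη : η ≠ 0) {d : ℕ} (hd : 2 ≤ d)
    (V : S → 𝔸ˣ) (A : S → 𝔸) (μ : ι) (x : S) :
    (η : ℂ) ^ (d - 2) * (wil τ (holU (letters2 T A μ x) * bondU T V μ x) - wil τ (bondU T V μ x))
      = (η : ℂ) ^ d * τ (pdη T η A μ x * Jb T η V μ x)
        + 2⁻¹ * ((η : ℂ) ^ d * τ (pdη T η A μ x * pdη T η A μ x)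
          + (η : ℂ) ^ d * (τ (pdη T η A μ x * pdη T η A μ x * (reC (bondU T V μ x) - 1))
            + τ ((I • ad (A x) (pdη T η A μ x)) * (((η : ℂ)⁻¹) • imC (bondU T V μ x)))))
        + (η : ℂ) ^ (d - 2) * remCh T τ V A μ x := by
  have hη' : (η : ℂ) ≠ 0 := Complex.ofReal_ne_zero.mpr hη
  have hpow : (η : ℂ) ^ d = (η : ℂ) ^ (d - 2) * (η : ℂ) ^ 2 := by rw [← pow_add, Nat.sub_add_cancel hd]
  rw [wil_holonomy_mul τ hτ, sum_letters2 T hη, commSum_letters2 T hη, remCh, Jb]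
  set X := pdη T η A μ x
  set W := bondU T V μ x
  set C := ad (A x) X
  have h2 : τ (X * X * (reC W - 1)) = τ (X * X * reC W) - τ (X * X) := by rw [mul_sub, mul_one, map_sub]
  rw [h2]
  simp only [neg_mul, mul_neg, smul_mul_assoc, mul_smul_comm, smul_neg, smul_smul, map_neg, map_smul, smul_eq_mul, neg_neg]
  rw [hpow]
  field_simp
  ring_nf
  simp only [I_sq]
  ring

/-- **(3.189)–(3.192), EXACTLY** (the bond analogue of `B9Eq39Adjoint.eq312`): for a chiral background `U : T → 𝔸ˣ` of arbitrary
units, `U′ = e^{iA}` sitewise, a tracial `τ`, `η ≠ 0`, `d ≥ 2`,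
`A^η(U′U) = A^η(U) + ⟨∂^ηA, J⟩ + ½⟨A, Δ^η(U)A⟩ + η^{d−2}Σ_b ρ_b`
with `J = −η⁻¹ Im U(∂b)` (3.190), `⟨A,Δ^η(U)A⟩ = ⟨∂A,∂A⟩ + ⟨A,Δ′^η(U)A⟩` (3.191)/(3.192), and `ρ_b` third order (`norm_remCh_le`).
[folklore] [cite: Balaban1985BackgroundPropagators, (3.189) p.433, (3.190) p.433, (3.191) p.433, (3.192) p.433] -/
theorem eq3189 (τ : 𝔸 →ₗ[ℂ] ℂ) (hτ : ∀ a b : 𝔸, τ (a * b) = τ (b * a)) {η : ℝ} (hη : η ≠ 0) {d : ℕ} (hd : 2 ≤ d)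
    (V : S → 𝔸ˣ) (A : S → 𝔸) :
    chiralAction T η d τ (fun y => holU [I • A y] * V y)
      = chiralAction T η d τ V + bondPair η d τ (pdη T η A) (Jb T η V) + 2⁻¹ * hessCh T η d τ V A
        + (η : ℂ) ^ (d - 2) * ∑ x, ∑ μ, remCh T τ V A μ x := by
  have hdiff : chiralAction T η d τ (fun y => holU [I • A y] * V y) - chiralAction T η d τ V
      = bondPair η d τ (pdη T η A) (Jb T η V) + 2⁻¹ * hessCh T η d τ V A
        + (η : ℂ) ^ (d - 2) * ∑ x, ∑ μ, remCh T τ V A μ x := by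
    calc chiralAction T η d τ (fun y => holU [I • A y] * V y) - chiralAction T η d τ V
        = ∑ x, ∑ μ, (η : ℂ) ^ (d - 2)
            * (wil τ (holU (letters2 T A μ x) * bondU T V μ x) - wil τ (bondU T V μ x)) := by
          simp only [chiralAction, ← Finset.sum_sub_distrib, ← mul_sub, wil_bondU_fluct T τ hτ]
      _ = ∑ x, ∑ μ, ((η : ℂ) ^ d * τ (pdη T η A μ x * Jb T η V μ x)
            + 2⁻¹ * ((η : ℂ) ^ d * τ (pdη T η A μ x * pdη T η A μ x)
              + (η : ℂ) ^ d * (τ (pdη T η A μ x * pdη T η A μ x * (reC (bondU T V μ x) - 1))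
                + τ ((I • ad (A x) (pdη T η A μ x)) * (((η : ℂ)⁻¹) • imC (bondU T V μ x)))))
            + (η : ℂ) ^ (d - 2) * remCh T τ V A μ x) :=
          Finset.sum_congr rfl fun x _ => Finset.sum_congr rfl fun μ _ => summand_split T τ hτ hη hd V A μ x
      _ = _ := by
          simp only [Finset.sum_add_distrib, ← Finset.mul_sum, bondPair, hessCh, deltaPrimeCh]
  linear_combination hdiff

end Expansion

/-! ## §3  (3.193): the non-linear average `Q_j(U, A)` of the chiral model -/

section Average

variable {𝔸 : Type*} [NormedRing 𝔸] [NormedAlgebra ℂ 𝔸] [CompleteSpace 𝔸] {d : ℕ}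

/-- (3.193): «Q_j(U, A) = (1/i) log Ū′^j = (1/i) log (U′U)‾^j (Ū^j)⁻¹», `U′ = e^{iA}`, with «the formulas (61), (78)–(80) in [5],
with the external gauge field U₀ = 1»: the `j`-fold site average of [Balaban1985Averaging] (78)–(80) at the trivial background
(`B7Eq84Concrete.uavg L 1`, block size `L`, sites `ℤ^d`) and the logarithm series `MatrixLog.mlog`; read on the `j`-lattice site `y`.
[folklore] [cite: Balaban1985BackgroundPropagators, (3.193) p.433] [cite: Balaban1985Averaging, (78)–(80) p.30] -/
def Qj (L : ℕ) (U : B7Prop1Explicit.Site d → 𝔸ˣ) (A : B7Prop1Explicit.Site d → 𝔸) (j : ℕ) (y : B7Prop1Explicit.Site d) : 𝔸 :=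
  I⁻¹ • MatrixLog.mlog (((B7Eq84Concrete.uavg L (1 : B7Prop1Explicit.Site d → Fin d → 𝔸ˣ)
      (fun x => B7Prop1Explicit.expUnit (I • A x) * U x) j y
    * (B7Eq84Concrete.uavg L (1 : B7Prop1Explicit.Site d → Fin d → 𝔸ˣ) U j y)⁻¹ : 𝔸ˣ)) : 𝔸)

/-- Unfolding `Qj`. [folklore] [cite: Balaban1985BackgroundPropagators, (3.193) p.433] -/
theorem Qj_apply (L : ℕ) (U : B7Prop1Explicit.Site d → 𝔸ˣ) (A : B7Prop1Explicit.Site d → 𝔸) (j : ℕ) (y : B7Prop1Explicit.Site d) :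
    Qj L U A j y = I⁻¹ • MatrixLog.mlog (((B7Eq84Concrete.uavg L (1 : B7Prop1Explicit.Site d → Fin d → 𝔸ˣ)
        (fun x => B7Prop1Explicit.expUnit (I • A x) * U x) j y
      * (B7Eq84Concrete.uavg L (1 : B7Prop1Explicit.Site d → Fin d → 𝔸ˣ) U j y)⁻¹ : 𝔸ˣ)) : 𝔸) := rfl

/-- At `A = 0` the fluctuation is trivial and `Q_j(U, 0) = 0` («expanding in A», (3.194), starts at first order). [folklore]
[cite: Balaban1985BackgroundPropagators, (3.193)–(3.194) p.433] -/
theorem Qj_zero (L : ℕ) (U : B7Prop1Explicit.Site d → 𝔸ˣ) (j : ℕ) (y : B7Prop1Explicit.Site d) :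
    Qj L U (fun _ => 0) j y = 0 := by
  have h : (fun x => B7Prop1Explicit.expUnit (I • (0 : 𝔸)) * U x) = U := by
    funext x
    ext
    simp
  rw [Qj, h, mul_inv_cancel, Units.val_one, MatrixLog.mlog_one, smul_zero]

end Average

/-! ## §4  Sanity examples -/

section Examples

variable {𝔸 : Type*} [NormedRing 𝔸] [NormedAlgebra ℂ 𝔸] [CompleteSpace 𝔸] {S : Type*} [Fintype S] {ι : Type*} [Fintype ι]
variable (T : ι → Equiv.Perm S)

/-- A CONSTANT chiral field has trivial bond variables … -/
example (g : 𝔸ˣ) (μ : ι) (x : S) : bondU T (fun _ => g) μ x = 1 := by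
  simp [bondU]

/-- … hence zero action and zero current. -/
example (g : 𝔸ˣ) (η : ℝ) (d : ℕ) (τ : 𝔸 →ₗ[ℂ] ℂ) : chiralAction T η d τ (fun _ => g) = 0 := by
  simp [chiralAction, bondU]

example (g : 𝔸ˣ) (η : ℝ) (μ : ι) (x : S) : Jb T η (fun _ => g) μ x = 0 := by
  simp [Jb, bondU]

end Examples

end Literature.MathematicalPhysics.QuantumFieldTheory.Balaban1983to89.B9AppChiral
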